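import Literature.Barriers.ValiantsHypothesis.CT23EquationsForSmallCircuits
import Literature.Barriers.ValiantsHypothesis.GKSS17FSVPresentation
import Literature.Barriers.ValiantsHypothesis.AlgebraicNaturalProofsGenerators
import Literature.Barriers.ValiantsHypothesis.CT23Thm31Holds
import Literature.Computability.AlgebraicComplexity.KRSTSelection
import HarnessLib

/-!
# Succinct hitting sets for `VP` force `VPSPACE⁰_b ⊄ VP` — the algebraic half of
# Chatterjee–Tengse's "barrier on the barrier" (val-lit t24 g11)

Theorem-only companion of `CT23LowerBoundsFromSuccinctHittingSets.lean` and
`CT23EquationsForSmallCircuits.lean`; NO named facts, NO definitions. It puts into the kernel, in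
the tree's own vocabulary, the first clause of Chatterjee–Tengse, *Lower Bounds from Succinct
Hitting Sets* (arXiv:2309.07612), v2 Thm. 4.1 / the algebraic core of the proof of v2 Thm. 1.3
(§4.3): succinct hitting sets for `VP` turn the (unconditionally existing) `VPSPACE`-explicit
equations for `VP` into a separation of `VP` from bounded-degree `VPSPACE`. Printed (held text =
v1, `paper:arxiv-2309.07612`):

* v1 Theorem 44 (= v2 Thm. 4.1), p0017.txt:L25–L28: "Let `{H_m}` be a `VPSPACE_b`-explicit family
  of `m`-variate polynomial maps with `n(m) > 2m` outputs of degree `d₀(m) ∈ poly(m)`, and let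
  `d(n) ∈ poly(n)` be such that `d(n(m)) > 2m · d₀(m)`, for all large `m`. If the family `{H_m}`
  is a hitting set generator for `VP_d`, then `VP ≠ VPSPACE_b`. As a consequence, either
  `P ≠ PSPACE` or [a uniform `NC¹ ⊄ TC⁰` statement]."
* v1 §4.3 (proof of v2 Thm. 1.3), p0018.txt:L40–L62: "Suppose we have `VP_d`-succinct hitting sets
  for `VP` … the family `U_{n,d(n),t(n)}(x, y)` is a succinct hitting set generator for all of
  `VP` … any family of annihilators for these maps is outside `VP(N)`. We can now apply
  Theorem 3.1 to obtain a family of annihilators … in the class `VPSPACE_b` … Due to the hitting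
  property …, `VPSPACE_b(t(n)) ⊄ VP(N)`."

THE ARGUMENT FOLLOWED (it is the printed one, with the tree's Lemma 4.7 corollary in place of the
universal-circuit bookkeeping, which that corollary already contains). Fix a field `F` of
characteristic `0` and assume the tree's barrier hypothesis `SuccinctHittingSetsForVP F`
(`AlgebraicNaturalProofs.lean`; FSV Question 6 answered "yes": for every distinguisher exponent
`a` there are `b, n₀` with the coefficient vectors of `SmallCircuits F n b = {deg ≤ n, size ≤ n^b}`
hitting every nonzero distinguisher of size and degree `≤ N^a`, `N = binom(2n, n)`; over `ℂ` this
is crux `stmt-ValiantsHypothesis-14610` of route BarrierLever). By `smallCircuits_evalEquations`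
(CT23 Lemma 4.7, a THEOREM of the tree since `CT23_lemma_4_7_holds`) there are, for all large `n`,
nonzero multilinear integer polynomials `P_n` in the `N` evaluation coordinates, computed by
constant-free fan-in-two PROJECTION circuits of size `≤ n^c` (`c = c(b)`), vanishing at the
evaluation vector of every member of `SmallCircuits F n b`. By Prop. 4.6
(`exists_coeffEquation_of_evalEquation`) `D_n := P_n ∘ V` (`V` the simplex Vandermonde matrix) is a
nonzero equation for the COEFFICIENT vectors of `SmallCircuits F n b` with `deg D_n ≤ N` and
`L(D_n) ≤ L(P_n) + 2N²`; the hitting property says `D_n` is NOT a level-`(a+3)` distinguisher, so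
`L(D_n) > N^{a+3}`, whence `L(P_n) > N^a` (`N ≥ 3`):

* `hard_evalEquations_of_succinctHittingSetsForVP` — for every `a`: CT23's size-`n^{c}`
  projection-circuit equations for `VP_n(n^{b(a)})` need ordinary circuits of size `> binom(2n,n)^a`
  over `F`. ("Succinct hitting sets ⇒ hardness of the explicit equations", the sentence
  p0018.txt:L52–L53.)

Diagonalising over `a` (for each `n` take the largest `a ≤ n` whose thresholds are met — a choice
the source makes in the form "`t(n) = n^{f(n)}` for any `f(n) = ω(1)`", p0018.txt:L46) and indexing
the resulting integer family by `N` with `n = ⌊log₄ N⌋` (so that the `binom(2n, n) ≤ 4^n ≤ N`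
variables, the `≤ 2^n` workspace variables and gates, and the degree `≤ binom(2n,n)` are all
p-bounded in `N`):

* `exists_isVPSPACE0bFamily_not_isVPFamily_of_succinctHittingSetsForVP` — **`SuccinctHittingSetsForVP F`
  implies that some integer family in the tree's `VPSPACE⁰_b` (`IsVPSPACE0bFamily`: constant-free
  polynomial-size projection circuits, p-bounded degree) is NOT in `VP_F`
  (`¬ IsVPFamily` of its image over `F`)** — the tree-vocabulary form of "`VP ≠ VPSPACE_b`"
  (indeed the stronger constant-free form: the separating family uses no field constants).

WHAT IS NOT CLAIMED. The Boolean half of the "barrier on the barrier" — v2 Prop. 2.25 [KP09,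
Prop. 3] "if `VP ≠ VPSPACE_b` then either `VP ≠ VNP` or `P/poly ≠ PSPACE/poly`", the GRH /
uniform-`TC⁰` clauses of v2 Thm. 1.3 and the second clause of Thm. 4.1 — needs Poizat's
coefficient-function characterisation of `VPSPACE` and Boolean advice classes the tree does not
have; it stays prose (RULING (88)(b) of the val-lit desk; BarrierLever.lean records it at the
crux). HONEST READING (val-lit desk, RULING on this file): both theorems are CONSEQUENCES of the
open crux `stmt-ValiantsHypothesis-14610` (CT23 Thm. 1.1 / Thm. 4.1 first clause: succinct hitting
sets for `VP_F` ⇒ `VPSPACE⁰_b ⊄ VP_F`), i.e. strength / barrier-placement evidence for route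
BarrierLever (BC8 / tribunal material for its tenure planner), NOT lower bounds; crux 14610 (FSV
Question 6) is OPEN; characteristic `0` only (both CT23 inputs quantify `[CharZero F]`);
`VP ≠ VNP` is NOT proved and nothing here bears on it. Census-neutral (0 facts, 0 definitions).

## Main statements

* `hard_evalEquations_of_succinctHittingSetsForVP` — per distinguisher exponent `a`.
* `exists_isVPSPACE0bFamily_not_isVPFamily_of_succinctHittingSetsForVP` — the class separation
  `VPSPACE⁰_b ⊄ VP_F` from `SuccinctHittingSetsForVP F`.
* `exists_isVPSPACE0bFamily_not_isVPFamily_of_succinctGeneratorsForVP` — the same from succinct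
  hitting-set GENERATORS for `VP` (`SuccinctGeneratorsForVP`, FSV Def. 7; Thm. 4.1's hypothesis
  shape).
* `not_succinctHittingSetsForVP_of_vpspace0b_subset_vp` — contrapositive: a collapse
  `VPSPACE⁰_b ⊆ VP_F` gives algebraic natural proofs against `VP_F`.
* `exists_projFamily_not_isVPFamily_of_encodedHittingSetGenerators` (v2, same seat) — Thm. 4.1
  first clause in the generality of the hypothesis class of Thm. 1.9 / Thm. 4.1 itself: a family
  of polynomial maps `G_n : F^{m(n)} → F^{binom(2n,n)}` ENCODED (Def. 1.7) by polynomial-size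
  fan-in-two projection circuits, of polynomial degree, seed length `m(n) → ∞` with stretch
  `2 m(n) ≤ binom(2n, n)`, that is a hitting-set generator for `Distinguishers F n a` for every
  `a` (eventually in `n`), yields — through `CT23_thm_3_1_holds` (Thm. 3.1, annihilators of
  explicit maps) — a p-family over `F` with polynomial-size fan-in-two PROJECTION circuits that
  is NOT in `VP_F`. (The circuits carry arbitrary `F`-constants: this is the source's `VPSPACE_b`
  of Def. 2.22 up to the identification "projection circuit with constants = constant-free
  projection circuit with constants plugged in", which the tree does not have for `ProjCircuit`;
  the conclusion is therefore stated as explicit circuit data, not as `IsVPSPACEbFamily`.)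

## References

* [ChatterjeeTengse2023] P. Chatterjee, A. Tengse, *Lower Bounds from Succinct Hitting Sets*,
  arXiv:2309.07612: v2 Thm. 4.1 (v1 Thm. 44, p0017.txt:L25–L28), Remark 4.2 (v1 Rem. 45,
  p0017.txt:L30–L35), §4.3 proof of Thm. 1.3 (v1 p0018.txt:L40–L62, p0019.txt:L1–L8), Prop. 4.6
  (v1 Prop. 49), Lemma 4.7 (v1 Lemma 50).
* [ForbesShpilkaVolk2018] M. A. Forbes, A. Shpilka, B. L. Volk, *Succinct hitting sets and barriers
  to proving lower bounds for algebraic circuits*, Theory of Computing 14 (2018): Def. 1, Def. 3,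
  Question 6 (the tree's `SuccinctHittingSetsForVP`).
* [KoiranPerifel2009] P. Koiran, S. Perifel, *VPSPACE and a transfer theorem over the reals*,
  Comput. Complexity 18 (2009), Prop. 3 (the Boolean half, NOT formalised).
-/

open MvPolynomial

namespace Literature.Barriers.ValiantsHypothesis

open Literature.Computability.AlgebraicComplexity

/-! ### Arithmetic helpers -/

/-- A multilinear polynomial (every individual degree `≤ 1`) has total degree at most the number
of its variables. [cite: ChatterjeeTengse2023, Lemma 4.7 (v1: Lemma 50) — "multilinear equation"] -/
private theorem totalDegree_le_card_of_degreeOf_le_one {σ R : Type*} [Fintype σ] [CommSemiring R]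
    {P : MvPolynomial σ R} (h : ∀ v, P.degreeOf v ≤ 1) : P.totalDegree ≤ Fintype.card σ := by
  classical
  rw [totalDegree]
  refine Finset.sup_le fun m hm => ?_
  have hmv : ∀ v, m v ≤ 1 := fun v => (degreeOf_le_iff.1 (h v)) m hm
  calc (m.sum fun _ e => e) = ∑ v ∈ m.support, m v := rfl
    _ ≤ ∑ v ∈ m.support, 1 := Finset.sum_le_sum fun v _ => hmv v
    _ = m.support.card := by simp
    _ ≤ Fintype.card σ := Finset.card_le_univ _

/-- `binom(2n, n) ≥ 2n` (the middle binomial coefficient dominates `binom(2n, 1)`). [folklore] -/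
private theorem two_mul_le_choose_two_mul_self (n : ℕ) : 2 * n ≤ (2 * n).choose n := by
  have h1 : (2 * n).choose 1 ≤ (2 * n).choose (2 * n / 2) := Nat.choose_le_middle 1 (2 * n)
  rwa [Nat.choose_one_right, Nat.mul_div_cancel_left n (by norm_num : 0 < 2)] at h1

/-- `2^n ≤ binom(2n, n)`, through Mathlib's `Nat.centralBinom` recursion
`(n+1)·binom(2n+2, n+1) = 2(2n+1)·binom(2n, n)`. [folklore] -/
private theorem two_pow_le_centralBinom (n : ℕ) : 2 ^ n ≤ Nat.centralBinom n := by
  induction n with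
  | zero => simp
  | succ n ih =>
    have hrec := Nat.succ_mul_centralBinom_succ n
    -- `(n+1) · cB(n+1) = 2(2n+1) · cB n ≥ 2(n+1) · cB n`, so `cB(n+1) ≥ 2 · cB n`
    have h2 : (n + 1) * (2 * Nat.centralBinom n) ≤ (n + 1) * Nat.centralBinom (n + 1) := by
      rw [hrec]; nlinarith [Nat.centralBinom_pos n]
    have h3 : 2 * Nat.centralBinom n ≤ Nat.centralBinom (n + 1) :=
      Nat.le_of_mul_le_mul_left h2 (Nat.succ_pos n)
    calc 2 ^ (n + 1) = 2 * 2 ^ n := by ring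
      _ ≤ 2 * Nat.centralBinom n := Nat.mul_le_mul_left 2 ih
      _ ≤ Nat.centralBinom (n + 1) := h3

/-- `n^k ≤ 2^n` once `2^{2k} ≤ n`. [folklore] -/
private theorem pow_le_two_pow_of_two_pow_two_mul_le {k n : ℕ} (h : 2 ^ (2 * k) ≤ n) :
    n ^ k ≤ 2 ^ n := by
  rcases Nat.eq_zero_or_pos k with rfl | hk
  · simp [Nat.one_le_two_pow]
  have hn : 0 < n := lt_of_lt_of_le (by positivity) h
  set m := Nat.log 2 n with hm
  have h2m : 2 ^ m ≤ n := Nat.pow_log_le_self 2 hn.ne'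
  have hnlt : n < 2 ^ (m + 1) := Nat.lt_pow_succ_log_self (by norm_num) n
  -- `2^(2k) ≤ n < 2^(m+1)` gives `2k ≤ m`
  have h2k : 2 * k ≤ m := by
    have : 2 ^ (2 * k) < 2 ^ (m + 1) := lt_of_le_of_lt h hnlt
    have := (Nat.pow_lt_pow_iff_right (by norm_num : 1 < 2)).1 this
    omega
  -- `k (m + 1) ≤ m (m + 1) / 2 ≤ 2^m`
  have hkm : k * (m + 1) ≤ 2 ^ m := by
    have h1 : 2 * (k * (m + 1)) ≤ m * (m + 1) := by nlinarith
    have key : ∀ j : ℕ, j * (j + 1) ≤ 2 * 2 ^ j := by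
      intro j
      induction j with
      | zero => simp
      | succ j ih =>
        have h2 : 2 ^ (j + 1) = 2 * 2 ^ j := by ring
        have hj : j < 2 ^ j := Nat.lt_two_pow_self
        nlinarith [hj, ih]
    have := key m
    omega
  calc n ^ k ≤ (2 ^ (m + 1)) ^ k := Nat.pow_le_pow_left hnlt.le k
    _ = 2 ^ (k * (m + 1)) := by rw [← pow_mul, mul_comm]
    _ ≤ 2 ^ (2 ^ m) := Nat.pow_le_pow_right (by norm_num) hkm
    _ ≤ 2 ^ n := Nat.pow_le_pow_right (by norm_num) h2m

/-! ### Succinct hitting sets make CT23's explicit equations hard (per distinguisher exponent) -/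

section PerExponent

variable (F : Type) [Field F] [CharZero F]

/-- **Succinct hitting sets for `VP` ⇒ the `VPSPACE⁰`-explicit equations for `VP` are hard**
(Chatterjee–Tengse, the argument of v2 §4.3 / first clause of Thm. 4.1, on the tree's Lemma 4.7
corollary). Assume `SuccinctHittingSetsForVP F` (FSV Question 6 "yes"; over `ℂ` = crux
`stmt-ValiantsHypothesis-14610`). Then for every distinguisher exponent `a` there are `b, c, n₀`
such that for every `n ≥ n₀` CT23's equation package for `SmallCircuits F n b` — a nonzero
MULTILINEAR integer polynomial `P` in the `binom(2n, n)` evaluation coordinates `x^{≤ n}`,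
computed (as `rename Sum.inl P`, with `t ≤ n^c` bound workspace variables) by a constant-free
fan-in-two circuit with projection gates of size `≤ n^c`, vanishing at the evaluation vector of
every `f ∈ SmallCircuits F n b` — has ordinary circuit complexity over `F`
`complexity (P ⊗ F) > binom(2n, n)^a`. Proof: `D := P ∘ V` (Prop. 4.6,
`exists_coeffEquation_of_evalEquation`) is a nonzero equation for the coefficient vectors of
`SmallCircuits F n b` of degree `≤ N` and complexity `≤ L(P) + 2N²`; by the hitting property it is
not a level-`(a+3)` distinguisher, so `L(D) > N^{a+3} ≥ N^a + 2N²` (`N = binom(2n,n) ≥ 3`).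
HONEST READING: a CONSEQUENCE of the open hypothesis, i.e. a measure of its strength; not a lower
bound. [cite: ChatterjeeTengse2023, Thm. 4.1 first clause and §4.3 (v1: Thm. 44, p0017.txt:L25–L28; p0018.txt:L40–L62)] -/
theorem hard_evalEquations_of_succinctHittingSetsForVP (h : SuccinctHittingSetsForVP F) (a : ℕ) :
    ∃ b c n₀ : ℕ, ∀ n : ℕ, n₀ ≤ n →
      ∃ (t : ℕ) (P : MvPolynomial (monomialsDegLE n n) ℤ)
        (Q : ProjCircuit ℤ (monomialsDegLE n n ⊕ Fin t)),
        P ≠ 0 ∧ (∀ v, P.degreeOf v ≤ 1) ∧ Q.IsFanInTwo ∧ Q.HasSignConstants ∧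
          Q.Computes (rename Sum.inl P) ∧ t ≤ n ^ c ∧ Q.size ≤ n ^ c ∧
          (∀ f ∈ SmallCircuits F n b,
              eval (evalVector F n f) (MvPolynomial.map (Int.castRingHom F) P) = 0) ∧
          ((2 * n).choose n) ^ a < complexity (MvPolynomial.map (Int.castRingHom F) P) := by
  classical
  obtain ⟨b, n₁, hb⟩ := h (a + 3)
  obtain ⟨c, n₂, hc⟩ := smallCircuits_evalEquations F b
  refine ⟨b, c, max (max n₁ n₂) 2, fun n hn => ?_⟩
  have hn₁ : n₁ ≤ n := le_trans (le_trans (le_max_left _ _) (le_max_left _ _)) hn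
  have hn₂ : n₂ ≤ n := le_trans (le_trans (le_max_right _ _) (le_max_left _ _)) hn
  have h2 : 2 ≤ n := le_trans (le_max_right _ _) hn
  obtain ⟨t, P, Q, hP0, hPml, hQ2, hQsc, hQc, ht, hQs, hvan⟩ := hc n hn₂
  refine ⟨t, P, Q, hP0, hPml, hQ2, hQsc, hQc, ht, hQs, hvan, ?_⟩
  letI : Fintype (monomialsDegLE n n) := degLEMonomials.instFintype n
  -- the number of coordinates
  have hcard : Fintype.card (monomialsDegLE n n) = (2 * n).choose n := by
    have := GKSS2017.card_degLEMonomials n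
    rwa [Nat.card_eq_fintype_card] at this
  have hN3 : 3 ≤ (2 * n).choose n := by
    have := two_mul_le_choose_two_mul_self n
    omega
  have hN1 : 1 ≤ (2 * n).choose n := by omega
  -- the equation read over `F`
  have hE0 : MvPolynomial.map (Int.castRingHom F) P ≠ 0 := fun hE =>
    hP0 (MvPolynomial.map_injective (Int.castRingHom F) (Int.castRingHom F).injective_int
      (by rw [hE, map_zero]))
  have hdegE : (MvPolynomial.map (Int.castRingHom F) P).totalDegree ≤ (2 * n).choose n :=
    calc (MvPolynomial.map (Int.castRingHom F) P).totalDegree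
        ≤ P.totalDegree := by
          rw [totalDegree, totalDegree]; exact Finset.sup_mono (support_map_subset _ _)
      _ ≤ Fintype.card (monomialsDegLE n n) := totalDegree_le_card_of_degreeOf_le_one hPml
      _ = (2 * n).choose n := hcard
  -- Prop. 4.6: an equation for the COEFFICIENT vectors of `SmallCircuits F n b`
  obtain ⟨D, hD0, hDdeg, hDcx, hDvan⟩ :=
    exists_coeffEquation_of_evalEquation F (SmallCircuits F n b) (fun f hf => hf.1) hE0 hvan
  rw [hcard] at hDcx
  -- the hitting property: `D` is not a distinguisher of level `a + 3`
  have hnot : ¬ (complexity D ≤ ((2 * n).choose n) ^ (a + 3) ∧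
      D.totalDegree ≤ ((2 * n).choose n) ^ (a + 3)) := by
    intro hDist
    obtain ⟨f, hf, hne⟩ := hb n hn₁ D hDist hD0
    exact hne (hDvan f hf)
  have hdegD : D.totalDegree ≤ ((2 * n).choose n) ^ (a + 3) :=
    (hDdeg.trans hdegE).trans
      (calc (2 * n).choose n = ((2 * n).choose n) ^ 1 := (pow_one _).symm
        _ ≤ ((2 * n).choose n) ^ (a + 3) := Nat.pow_le_pow_right hN1 (by omega))
  have hcxD : ((2 * n).choose n) ^ (a + 3) < complexity D := by
    by_contra hle
    exact hnot ⟨not_lt.1 hle, hdegD⟩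
  -- arithmetic: `N^(a+3) ≥ N^a + 2N²` for `N ≥ 3`
  have hNa : 1 ≤ ((2 * n).choose n) ^ a := Nat.one_le_pow _ _ hN1
  have key : ((2 * n).choose n) ^ a + 2 * ((2 * n).choose n) ^ 2 ≤
      ((2 * n).choose n) ^ (a + 3) := by
    have hN2 : 9 ≤ ((2 * n).choose n) ^ 2 := by nlinarith [hN3]
    have h3 : 1 + 2 * ((2 * n).choose n) ^ 2 ≤ ((2 * n).choose n) ^ 3 := by
      have : ((2 * n).choose n) ^ 3 = (2 * n).choose n * ((2 * n).choose n) ^ 2 := by ring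
      rw [this]; nlinarith [hN3, hN2]
    calc ((2 * n).choose n) ^ a + 2 * ((2 * n).choose n) ^ 2
        ≤ ((2 * n).choose n) ^ a * 1 + ((2 * n).choose n) ^ a * (2 * ((2 * n).choose n) ^ 2) := by
          nlinarith [hNa]
      _ = ((2 * n).choose n) ^ a * (1 + 2 * ((2 * n).choose n) ^ 2) := by ring
      _ ≤ ((2 * n).choose n) ^ a * ((2 * n).choose n) ^ 3 := Nat.mul_le_mul_left _ h3
      _ = ((2 * n).choose n) ^ (a + 3) := by rw [← pow_add]
  by_contra hle
  rw [not_lt] at hle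
  have : ((2 * n).choose n) ^ (a + 3) <
      ((2 * n).choose n) ^ a + 2 * ((2 * n).choose n) ^ 2 :=
    calc ((2 * n).choose n) ^ (a + 3) < complexity D := hcxD
      _ ≤ complexity (MvPolynomial.map (Int.castRingHom F) P) + 2 * ((2 * n).choose n) ^ 2 := hDcx
      _ ≤ ((2 * n).choose n) ^ a + 2 * ((2 * n).choose n) ^ 2 := by omega
  omega

end PerExponent

/-! ### The class separation: `VPSPACE⁰_b ⊄ VP_F` -/

section Separation

variable (F : Type) [Field F] [CharZero F]

/-- **Succinct hitting sets for `VP` ⇒ `VPSPACE⁰_b ⊄ VP`** (Chatterjee–Tengse, v2 Thm. 4.1 first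
clause "If the family `{H_m}` is a hitting set generator for `VP_d`, then `VP ≠ VPSPACE_b`" / the
conclusion "`VPSPACE_b(t(n)) ⊄ VP(N)`" of §4.3, in the tree's classes). Assume
`SuccinctHittingSetsForVP F` (over `ℂ`: crux `stmt-ValiantsHypothesis-14610` of route
BarrierLever). Then there is an INTEGER family `P = (P_N)_N`, `P_N` a polynomial in the
`binom(2n, n)` variables `x^{≤ n}` with `n = ⌊log₄ N⌋`, such that

* `P ∈ VPSPACE⁰_b` (`IsVPSPACE0bFamily`: p-bounded number of variables, constant-free fan-in-two
  circuits with projection gates of p-bounded size over p-boundedly many bound workspace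
  variables, p-bounded degree — here `≤ N` variables, `≤ 2^n ≤ N` gates and workspace variables,
  degree `≤ N`), and
* the family `(P_N ⊗ F)_N` is NOT in `VP_F` (`¬ IsVPFamily`): its circuit complexity over `F` is
  not p-bounded.

Construction: diagonalise `hard_evalEquations_of_succinctHittingSetsForVP` over the exponent `a`
— at level `n` use the largest `a ≤ n` whose thresholds `n₀(a) ≤ n`, `2^{2c(a)} ≤ n` are met
(`Nat.findGreatest`; the zero polynomial with the empty circuit below all thresholds), so that the
projection-circuit size `n^{c(a)} ≤ 2^n` stays polynomial in `N ≥ 4^n` while the lower bound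
`binom(2n,n)^{a(n)} ≥ 2^{n·a(n)}` eventually beats every `(4^n)^e + e` (test at `N = 4^n`). The
source phrases the same diagonal as "`t(n) = n^{f(n)}` for any `f(n) = ω(1)`". HONEST READING: the
ALGEBRAIC half of CT23's "barrier on the barrier" — proving the open hypothesis (FSV Question 6 /
crux 14610) would separate `VP_F` from (constant-free) bounded-degree `VPSPACE`; the Boolean
consequences (KP09 Prop. 3: then `VP ≠ VNP ∨ P/poly ≠ PSPACE/poly`; the GRH / uniform-`TC⁰`
clauses) are NOT formalised. Not a lower bound; `VP ≠ VNP` is NOT proved.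
[cite: ChatterjeeTengse2023, Thm. 4.1 first clause and §4.3 (v1: Thm. 44, p0017.txt:L25–L28; p0018.txt:L40–L62, p0019.txt:L1–L8)] -/
theorem exists_isVPSPACE0bFamily_not_isVPFamily_of_succinctHittingSetsForVP
    (h : SuccinctHittingSetsForVP F) :
    ∃ P : ∀ N : ℕ, MvPolynomial (degLEMonomials (Nat.log 4 N)) ℤ,
      IsVPSPACE0bFamily P ∧
        ¬ IsVPFamily (fun N => MvPolynomial.map (Int.castRingHom F) (P N)) := by
  classical
  choose b c n₀ hA using hard_evalEquations_of_succinctHittingSetsForVP F h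
  -- the diagonal exponent `A n`: the largest `a ≤ n` whose thresholds are met at `n`
  obtain ⟨A, hAdef⟩ : ∃ A : ℕ → ℕ, ∀ n,
      A n = Nat.findGreatest (fun a => n₀ a ≤ n ∧ 2 ^ (2 * c a) ≤ n) n := ⟨_, fun _ => rfl⟩
  -- level data with UNIFORM bounds (`≤ 2^n`), the zero polynomial below the thresholds
  have hLD : ∀ n : ℕ, ∃ (t : ℕ) (P : MvPolynomial (degLEMonomials n) ℤ)
      (Q : ProjCircuit ℤ (degLEMonomials n ⊕ Fin t)),
      Q.IsFanInTwo ∧ Q.HasSignConstants ∧ Q.Computes (rename Sum.inl P) ∧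
        (∀ v, P.degreeOf v ≤ 1) ∧ t ≤ 2 ^ n ∧ Q.size ≤ 2 ^ n ∧
        ((n₀ (A n) ≤ n ∧ 2 ^ (2 * c (A n)) ≤ n) →
          ((2 * n).choose n) ^ (A n) < complexity (MvPolynomial.map (Int.castRingHom F) P)) := by
    intro n
    by_cases hg : n₀ (A n) ≤ n ∧ 2 ^ (2 * c (A n)) ≤ n
    · obtain ⟨t, P, Q, -, hPml, hQ2, hQsc, hQc, ht, hQs, -, hhard⟩ := hA (A n) n hg.1
      have hpow : n ^ c (A n) ≤ 2 ^ n := pow_le_two_pow_of_two_pow_two_mul_le hg.2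
      exact ⟨t, P, Q, hQ2, hQsc, hQc, hPml, ht.trans hpow, hQs.trans hpow, fun _ => hhard⟩
    · refine ⟨0, 0, ProjCircuit.ofArithCircuit (ArithCircuit.ofConst 0), ?_, ?_, ?_, ?_,
        Nat.zero_le _, ?_, fun hg' => absurd hg' hg⟩
      · intro g hg'
        simp [ProjCircuit.ofArithCircuit, ArithCircuit.ofConst] at hg'
      · refine ProjCircuit.hasSignConstants_ofArithCircuit ⟨?_, ?_⟩
        · intro g hg'
          simp [ArithCircuit.ofConst] at hg'
        · show ArithCircuit.IsSignConstant (0 : ℤ)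
          exact Or.inl rfl
      · show (ProjCircuit.ofArithCircuit (ArithCircuit.ofConst (0 : ℤ))).eval = rename Sum.inl 0
        rw [ProjCircuit.eval_ofArithCircuit, ArithCircuit.eval_ofConst, map_zero, map_zero]
      · intro v
        rw [degreeOf_zero]
        exact Nat.zero_le _
      · rw [ProjCircuit.size_ofArithCircuit, ArithCircuit.size_ofConst]
        exact Nat.zero_le _
  choose t P Q h2 hsc hcomp hml ht hsize hhard using hLD
  -- elementary bounds in `N` with `n = ⌊log₄ N⌋`
  have hlog : ∀ N : ℕ, 2 ^ Nat.log 4 N ≤ N + 1 := by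
    intro N
    rcases Nat.eq_zero_or_pos N with rfl | hN
    · simp
    · calc 2 ^ Nat.log 4 N ≤ 4 ^ Nat.log 4 N := Nat.pow_le_pow_left (by norm_num) _
        _ ≤ N := Nat.pow_log_le_self 4 hN.ne'
        _ ≤ N + 1 := Nat.le_succ N
  have hcard : ∀ n : ℕ, Fintype.card (degLEMonomials n) = (2 * n).choose n := by
    intro n
    have := GKSS2017.card_degLEMonomials n
    rwa [Nat.card_eq_fintype_card] at this
  have hcardN : ∀ N : ℕ, Fintype.card (degLEMonomials (Nat.log 4 N)) ≤ N + 1 := by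
    intro N
    rw [hcard]
    rcases Nat.eq_zero_or_pos N with rfl | hN
    · simp
    · calc (2 * Nat.log 4 N).choose (Nat.log 4 N) ≤ 2 ^ (2 * Nat.log 4 N) := Nat.choose_le_two_pow _ _
        _ = 4 ^ Nat.log 4 N := by rw [pow_mul]; norm_num
        _ ≤ N := Nat.pow_log_le_self 4 hN.ne'
        _ ≤ N + 1 := Nat.le_succ N
  refine ⟨fun N => P (Nat.log 4 N), ⟨⟨⟨1, fun N => by simpa using hcardN N⟩,
    fun N => t (Nat.log 4 N), fun N => Q (Nat.log 4 N), ⟨1, fun N => ?_⟩,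
    fun N => ⟨h2 _, hsc _, hcomp _⟩, ⟨1, fun N => ?_⟩⟩, ⟨1, fun N => ?_⟩⟩, ?_⟩
  · -- workspace variables
    simpa using (ht (Nat.log 4 N)).trans (hlog N)
  · -- size
    simpa using (hsize (Nat.log 4 N)).trans (hlog N)
  · -- degree
    simpa using (totalDegree_le_card_of_degreeOf_le_one (hml (Nat.log 4 N))).trans (hcardN N)
  · -- not in `VP_F`: test the p-bound at `N = 4^n` for a large good `n`
    rintro ⟨-, e, he⟩
    -- a level where the exponent `2e + 1` is available
    set a₀ := 2 * e + 1 with ha₀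
    obtain ⟨n, hn⟩ : ∃ n : ℕ, max (max a₀ 1) (max (n₀ a₀) (2 ^ (2 * c a₀))) ≤ n := ⟨_, le_rfl⟩
    have ha₀n : a₀ ≤ n := le_trans (le_trans (le_max_left _ _) (le_max_left _ _)) hn
    have h1n : 1 ≤ n := le_trans (le_trans (le_max_right _ _) (le_max_left _ _)) hn
    have hgood₀ : n₀ a₀ ≤ n ∧ 2 ^ (2 * c a₀) ≤ n :=
      ⟨le_trans (le_trans (le_max_left _ _) (le_max_right _ _)) hn,
        le_trans (le_trans (le_max_right _ _) (le_max_right _ _)) hn⟩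
    have hAn : a₀ ≤ A n := by
      rw [hAdef]
      exact Nat.le_findGreatest ha₀n hgood₀
    have hgoodA : n₀ (A n) ≤ n ∧ 2 ^ (2 * c (A n)) ≤ n := by
      have := Nat.findGreatest_spec (P := fun a => n₀ a ≤ n ∧ 2 ^ (2 * c a) ≤ n) ha₀n hgood₀
      rw [hAdef]
      exact this
    have hlow := hhard n hgoodA
    have hup := he (4 ^ n)
    simp only at hup
    rw [Nat.log_pow (by norm_num : 1 < 4)] at hup
    -- `2^(n a₀) ≤ binom(2n,n)^(A n) < complexity ≤ (4^n)^e + e`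
    have hC : 2 ^ n ≤ (2 * n).choose n := by
      have := two_pow_le_centralBinom n
      rwa [Nat.centralBinom_eq_two_mul_choose] at this
    have hchain : (2 ^ n) ^ a₀ ≤ (4 ^ n) ^ e + e :=
      calc (2 ^ n) ^ a₀ ≤ ((2 * n).choose n) ^ a₀ := Nat.pow_le_pow_left hC _
        _ ≤ ((2 * n).choose n) ^ (A n) :=
            Nat.pow_le_pow_right (lt_of_lt_of_le (by positivity) hC) hAn
        _ ≤ complexity (MvPolynomial.map (Int.castRingHom F) (P n)) := hlow.le
        _ ≤ (4 ^ n) ^ e + e := hup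
    -- but `(2^n)^(2e+1) = (4^n)^e · 2^n ≥ 2 (4^n)^e > (4^n)^e + e`
    have hsq : (2 ^ n) ^ a₀ = (4 ^ n) ^ e * 2 ^ n := by
      rw [ha₀, pow_succ, pow_mul, ← pow_mul 2 n 2, mul_comm n 2, pow_mul]
      norm_num
    have he4 : e < (4 ^ n) ^ e :=
      calc e < 2 ^ e := Nat.lt_two_pow_self
        _ ≤ (4 ^ n) ^ e := Nat.pow_le_pow_left
            (le_trans (by norm_num) (Nat.pow_le_pow_right (by norm_num) h1n)) _
    have h2n : 2 ≤ 2 ^ n :=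
      calc 2 = 2 ^ 1 := (pow_one 2).symm
        _ ≤ 2 ^ n := Nat.pow_le_pow_right (by norm_num) h1n
    have : (4 ^ n) ^ e + e < (2 ^ n) ^ a₀ := by
      rw [hsq]; nlinarith [he4, h2n]
    omega

/-- **Generator form.** The same separation from succinct hitting-set GENERATORS for `VP`
(`SuccinctGeneratorsForVP F`, FSV Def. 7 / Cor. 15; they give succinct hitting sets by FSV
Lemma 14, `succinctHittingSetsForVP_of_generators`) — the hypothesis shape of CT23 Thm. 4.1
("if the family `{H_m}` is a hitting set generator for `VP_d`, then `VP ≠ VPSPACE_b`") at the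
tree's `VP`-succinct generators. Consequence of an open hypothesis, not a lower bound.
[cite: ChatterjeeTengse2023, Thm. 4.1 first clause (v1: Thm. 44, p0017.txt:L25–L28)]
[cite: ForbesShpilkaVolk2018, Lemma 14 and Cor. 15] -/
theorem exists_isVPSPACE0bFamily_not_isVPFamily_of_succinctGeneratorsForVP
    (h : SuccinctGeneratorsForVP F) :
    ∃ P : ∀ N : ℕ, MvPolynomial (degLEMonomials (Nat.log 4 N)) ℤ,
      IsVPSPACE0bFamily P ∧
        ¬ IsVPFamily (fun N => MvPolynomial.map (Int.castRingHom F) (P N)) :=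
  exists_isVPSPACE0bFamily_not_isVPFamily_of_succinctHittingSetsForVP F
    (succinctHittingSetsForVP_of_generators h)

/-- **Contrapositive: a collapse `VPSPACE⁰_b ⊆ VP_F` yields algebraic natural proofs against
`VP_F`.** If every integer family in `VPSPACE⁰_b` (constant-free polynomial-size projection
circuits, p-bounded degree) becomes a `VP` family over `F`, then `SuccinctHittingSetsForVP F`
fails, i.e. (FSV Thm. 4, `exists_isNaturalProof_iff`) for some distinguisher exponent `a`, for
every `b`, infinitely often there is a `Distinguishers F n a`-natural proof against
`SmallCircuits F n b`. The form in which a BarrierLever planner meets the statement: the crux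
`stmt-ValiantsHypothesis-14610` DENIES this collapse. Consequence of the open hypothesis' strength,
not a lower bound. [cite: ChatterjeeTengse2023, Thm. 4.1 first clause (v1: Thm. 44, p0017.txt:L25–L28)] -/
theorem not_succinctHittingSetsForVP_of_vpspace0b_subset_vp
    (hsub : ∀ {σ : ℕ → Type} [∀ N, Fintype (σ N)] [∀ N, DecidableEq (σ N)]
      (P : ∀ N, MvPolynomial (σ N) ℤ), IsVPSPACE0bFamily P →
        IsVPFamily (fun N => MvPolynomial.map (Int.castRingHom F) (P N))) :
    ¬ SuccinctHittingSetsForVP F := by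
  intro h
  obtain ⟨P, hP, hnot⟩ := exists_isVPSPACE0bFamily_not_isVPFamily_of_succinctHittingSetsForVP F h
  exact hnot (hsub P hP)

end Separation

/-! ### Explicit (encoded) hitting-set generator families — Thm. 4.1 (i) for the hypothesis class of
Thm. 1.9, through Thm. 3.1 (`CT23_thm_3_1_holds`) (v2, same seat) -/

section EncodedGenerators

variable (F : Type) [Field F] [CharZero F]

/-- Individual degrees `≤ D` bound the total degree by `(#variables) · D`.
[cite: ChatterjeeTengse2023, Thm. 3.1 (v1: §3) — "individual degree at most 3·m·d"] -/
private theorem totalDegree_le_card_mul_of_degreeOf_le {σ R : Type*} [Fintype σ] [CommSemiring R]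
    {P : MvPolynomial σ R} {D : ℕ} (h : ∀ v, P.degreeOf v ≤ D) :
    P.totalDegree ≤ Fintype.card σ * D := by
  classical
  rw [totalDegree]
  refine Finset.sup_le fun m hm => ?_
  have hmv : ∀ v, m v ≤ D := fun v => (degreeOf_le_iff.1 (h v)) m hm
  calc (m.sum fun _ e => e) = ∑ v ∈ m.support, m v := rfl
    _ ≤ ∑ v ∈ m.support, D := Finset.sum_le_sum fun v _ => hmv v
    _ = m.support.card * D := by simp
    _ ≤ Fintype.card σ * D := Nat.mul_le_mul_right _ (Finset.card_le_univ _)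

/-- **Explicit hitting-set generator families for `VP` force a `VPSPACE`-type family outside `VP`**
(Chatterjee–Tengse, v2 Thm. 4.1 first clause: "Let `{H_m}` be a `VPSPACE_b`-explicit family of
`m`-variate polynomial maps with `n(m) > 2m` outputs of degree `d₀(m) ∈ poly(m)` … If the family
`{H_m}` is a hitting set generator for `VP_d`, then `VP ≠ VPSPACE_b`"; the hypothesis class of
Thm. 1.9 "lower bounds from cryptographic hitting set generators", here even
projection-circuit-explicit). Rendering on the tree's objects, indexed by the number `n` of
variables of the class that is hit (`N = binom(2n, n)` outputs indexed by `x^{≤ n}`, as for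
`Distinguishers F n a`): generators `G n : degLEMonomials n → F[z_1, …, z_{m(n)}]` ENCODED
(Def. 1.7, `Encodes (U n) (G n)`) by a polynomial `U n(z, y)` computed (as `rename Sum.inl (U n)`,
with `w(n)` bound workspace variables) by a fan-in-two projection circuit `Q n` of size `≤ s(n)`;
seed length `m(n) → ∞` with stretch `2 m(n) ≤ N` eventually; output degrees `≤ d(n)`,
`1 ≤ d(n)`, `2 ≤ s(n)`, and `d, s` polynomially bounded in `N`; hitting: for every level `a`,
eventually in `n`, `G n` is a hitting-set generator for `Distinguishers F n a`. CONCLUSION: a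
family `A = (A_N)_N` over `F`, `A_N` in `binom(2n, n)` variables with `n = ⌊log₄ N⌋`, which is a
p-family (`IsPFamily`), is computed — as `rename Sum.inl (A N)` over p-boundedly many workspace
variables — by fan-in-two PROJECTION circuits of p-bounded size (the source's `VPSPACE_b` of
Def. 2.22 up to constant extraction, see the module docstring), and is NOT in `VP_F`. Proof (the
printed one): at each good level `n`, Thm. 3.1 (`CT23_thm_3_1_holds`) applied to the encoded map
gives a nonzero annihilator `A_n` of individual degree `≤ 3 m d` with a projection circuit of size
`≤ (m d s)^c`; read on the coordinates `x^{≤ n}` (`rename` along `Fin N ≃ degLEMonomials n`) it is a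
nonzero polynomial killed by `bind₁ (G n)`, so by the hitting property it is NOT a level-`a′`
distinguisher for any `a′` whose threshold is below `n`; its degree is `≤ N^{k+3}`, whence
`complexity A_n > N^a` for every such level — superpolynomial along `N = 4^n`. No diagonal is needed
(one annihilator per `n` serves all levels). HONEST READING: a CONSEQUENCE of a hypothesis nobody
has established (explicit HSG families of this stretch against all polynomial-size distinguishers
are not known; Remark 4.2: the `PSPACE`-constructions of Mulmuley / Forbes–Shpilka do not qualify);
not a lower bound; `VP ≠ VNP` is NOT proved.
[cite: ChatterjeeTengse2023, Thm. 4.1 first clause, Thm. 1.9 and Remark 4.2 (v1: Thm. 44, p0017.txt:L25–L35; §4.1 p0017.txt:L9–L22)] -/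
theorem exists_projFamily_not_isVPFamily_of_encodedHittingSetGenerators
    {m r w s d : ℕ → ℕ}
    (G : ∀ n : ℕ, degLEMonomials n → MvPolynomial (Fin (m n)) F)
    (U : ∀ n : ℕ, MvPolynomial (Fin (m n) ⊕ Fin (r n)) F)
    (Q : ∀ n : ℕ, ProjCircuit F ((Fin (m n) ⊕ Fin (r n)) ⊕ Fin (w n)))
    (hQ : ∀ n, (Q n).IsFanInTwo ∧ (Q n).Computes (rename Sum.inl (U n)) ∧ (Q n).size ≤ s n)
    (henc : ∀ n, Encodes (U n) (G n))
    (hm : ∀ m₀ : ℕ, ∃ n₁ : ℕ, ∀ n, n₁ ≤ n → m₀ ≤ m n)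
    (hstretch : ∃ n₁ : ℕ, ∀ n, n₁ ≤ n → 2 * m n ≤ (2 * n).choose n)
    (hdeg : ∀ n μ, (G n μ).totalDegree ≤ d n) (hd₁ : ∀ n, 1 ≤ d n)
    (hd : ∃ k : ℕ, ∀ n, d n ≤ ((2 * n).choose n) ^ k + k)
    (hs₂ : ∀ n, 2 ≤ s n) (hs : ∃ k : ℕ, ∀ n, s n ≤ ((2 * n).choose n) ^ k + k)
    (hhit : ∀ a : ℕ, ∃ n₀ : ℕ, ∀ n, n₀ ≤ n →
      IsHittingSetGenerator (Distinguishers F n a) (G n)) :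
    ∃ (A : ∀ N : ℕ, MvPolynomial (Fin ((2 * Nat.log 4 N).choose (Nat.log 4 N))) F)
      (t : ℕ → ℕ)
      (Cq : ∀ N : ℕ, ProjCircuit F (Fin ((2 * Nat.log 4 N).choose (Nat.log 4 N)) ⊕ Fin (t N))),
      IsPFamily A ∧ IsPBounded t ∧
        (∀ N, (Cq N).IsFanInTwo ∧ (Cq N).Computes (rename Sum.inl (A N))) ∧
        IsPBounded (fun N => (Cq N).size) ∧ ¬ IsVPFamily A := by
  classical
  obtain ⟨c, m₀, h31⟩ := CT23_thm_3_1_holds F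
  obtain ⟨n₁, hn₁⟩ := hstretch
  obtain ⟨n₂, hn₂⟩ := hm m₀
  obtain ⟨k, hk⟩ := hd
  obtain ⟨k', hk'⟩ := hs
  choose n₀ hn₀ using hhit
  have hcard : ∀ n : ℕ, Fintype.card (degLEMonomials n) = (2 * n).choose n := by
    intro n
    have := GKSS2017.card_degLEMonomials n
    rwa [Nat.card_eq_fintype_card] at this
  -- level data with uniform bounds; the zero polynomial at the (finitely many) bad levels
  have hLD : ∀ n : ℕ, ∃ (t : ℕ) (A : MvPolynomial (Fin ((2 * n).choose n)) F)
      (Cq : ProjCircuit F (Fin ((2 * n).choose n) ⊕ Fin t)),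
      Cq.IsFanInTwo ∧ Cq.Computes (rename Sum.inl A) ∧
        t ≤ ((2 * n).choose n * (((2 * n).choose n) ^ k + k) *
          (((2 * n).choose n) ^ k' + k')) ^ c ∧
        Cq.size ≤ ((2 * n).choose n * (((2 * n).choose n) ^ k + k) *
          (((2 * n).choose n) ^ k' + k')) ^ c ∧
        A.totalDegree ≤ ((2 * n).choose n) ^ (k + 3) ∧
        (max (max n₁ n₂) 2 ≤ n → ∀ a : ℕ, n₀ (a + (k + 3)) ≤ n →
          ((2 * n).choose n) ^ a < complexity A) := by
    intro n
    by_cases hb : max (max n₁ n₂) 2 ≤ n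
    · have hn1 : n₁ ≤ n := le_trans (le_trans (le_max_left _ _) (le_max_left _ _)) hb
      have hn2 : n₂ ≤ n := le_trans (le_trans (le_max_right _ _) (le_max_left _ _)) hb
      have h2 : 2 ≤ n := le_trans (le_max_right _ _) hb
      have hN4 : 4 ≤ (2 * n).choose n := by
        have := two_mul_le_choose_two_mul_self n
        omega
      have hmN : 2 * m n ≤ (2 * n).choose n := hn₁ n hn1
      -- reindex the outputs by `Fin N`
      let e : Fin ((2 * n).choose n) ≃ degLEMonomials n := (Fintype.equivFinOfCardEq (hcard n)).symm
      obtain ⟨t, A, Cq, hA0, hAdeg, hAG, hC2, hCc, ht, hCs⟩ :=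
        h31 (m n) ((2 * n).choose n) (d n) (s n) (r n) (w n) (fun i => G n (e i)) (U n) (Q n)
          (hn₂ n hn2) hmN (hd₁ n) (hs₂ n) (fun i => hdeg n (e i)) (hQ n).1 (hQ n).2.1 (hQ n).2.2
          (fun i => henc n (e i))
      have hmds : m n * d n * s n ≤
          (2 * n).choose n * (((2 * n).choose n) ^ k + k) * (((2 * n).choose n) ^ k' + k') :=
        Nat.mul_le_mul (Nat.mul_le_mul (by omega) (hk n)) (hk' n)
      -- degree bound `≤ N^(k+3)`
      have hkN : k ≤ ((2 * n).choose n) ^ k := (Nat.lt_pow_self (by omega)).le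
      have hdegA : A.totalDegree ≤ ((2 * n).choose n) ^ (k + 3) := by
        calc A.totalDegree ≤ Fintype.card (Fin ((2 * n).choose n)) * (3 * m n * d n) :=
              totalDegree_le_card_mul_of_degreeOf_le hAdeg
          _ = (2 * n).choose n * (3 * m n * d n) := by rw [Fintype.card_fin]
          _ ≤ (2 * n).choose n * (2 * (2 * n).choose n * (((2 * n).choose n) ^ k + k)) := by
              apply Nat.mul_le_mul_left
              exact Nat.mul_le_mul (by omega) (hk n)
          _ ≤ (2 * n).choose n * ((2 * n).choose n * ((2 * n).choose n * ((2 * n).choose n) ^ k)) := by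
              apply Nat.mul_le_mul_left
              calc 2 * (2 * n).choose n * (((2 * n).choose n) ^ k + k)
                  ≤ 2 * (2 * n).choose n * (((2 * n).choose n) ^ k + ((2 * n).choose n) ^ k) :=
                    Nat.mul_le_mul_left _ (Nat.add_le_add_left hkN _)
                _ = 4 * ((2 * n).choose n * ((2 * n).choose n) ^ k) := by ring
                _ ≤ (2 * n).choose n * ((2 * n).choose n * ((2 * n).choose n) ^ k) :=
                    Nat.mul_le_mul_right _ hN4
          _ = ((2 * n).choose n) ^ (k + 3) := by ring
      refine ⟨t, A, Cq, hC2, hCc, ht.trans (Nat.pow_le_pow_left hmds c),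
        hCs.trans (Nat.pow_le_pow_left hmds c), hdegA, fun _ a ha => ?_⟩
      -- hardness at every level `a` whose threshold is below `n`
      have hN1 : 1 ≤ (2 * n).choose n := by omega
      have hD0 : rename e A ≠ 0 := fun h0 =>
        hA0 (MvPolynomial.rename_injective _ e.injective (by rw [h0, map_zero]))
      have hDG : bind₁ (G n) (rename e A) = 0 := by
        rw [← MvPolynomial.aeval_eq_bind₁, MvPolynomial.aeval_rename]
        exact hAG
      have hdegD : (rename e A).totalDegree ≤ ((2 * n).choose n) ^ (a + (k + 3)) :=
        ((totalDegree_rename_le _ _).trans hdegA).trans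
          (Nat.pow_le_pow_right hN1 (by omega))
      have hnot : ¬ (complexity (rename e A) ≤ ((2 * n).choose n) ^ (a + (k + 3)) ∧
          (rename e A).totalDegree ≤ ((2 * n).choose n) ^ (a + (k + 3))) :=
        fun hmem => hn₀ (a + (k + 3)) n ha _ hmem hD0 hDG
      have hcx : ((2 * n).choose n) ^ (a + (k + 3)) < complexity (rename e A) := by
        by_contra hle
        exact hnot ⟨not_lt.1 hle, hdegD⟩
      have hren : complexity (rename e A) = complexity A := by
        have := complexity_renameEquiv_holds (k := F) e A
        rwa [MvPolynomial.renameEquiv_apply] at this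
      calc ((2 * n).choose n) ^ a ≤ ((2 * n).choose n) ^ (a + (k + 3)) :=
            Nat.pow_le_pow_right hN1 (by omega)
        _ < complexity (rename e A) := hcx
        _ = complexity A := hren
    · refine ⟨0, 0, ProjCircuit.ofArithCircuit (ArithCircuit.ofConst 0), ?_, ?_, Nat.zero_le _,
        ?_, ?_, fun hb' => absurd hb' hb⟩
      · intro g hg'
        simp [ProjCircuit.ofArithCircuit, ArithCircuit.ofConst] at hg'
      · show (ProjCircuit.ofArithCircuit (ArithCircuit.ofConst (0 : F))).eval = rename Sum.inl 0
        rw [ProjCircuit.eval_ofArithCircuit, ArithCircuit.eval_ofConst, map_zero, map_zero]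
      · rw [ProjCircuit.size_ofArithCircuit, ArithCircuit.size_ofConst]
        exact Nat.zero_le _
      · rw [totalDegree_zero]
        exact Nat.zero_le _
  choose t A Cq hC2 hCc ht hCs hAdeg hhard using hLD
  -- bounds in `N` with `n = ⌊log₄ N⌋`: `binom(2n, n) ≤ 4^n ≤ N`
  have hM : ∀ N : ℕ, (2 * Nat.log 4 N).choose (Nat.log 4 N) ≤ N + 1 := by
    intro N
    rcases Nat.eq_zero_or_pos N with rfl | hN
    · simp
    · calc (2 * Nat.log 4 N).choose (Nat.log 4 N) ≤ 2 ^ (2 * Nat.log 4 N) := Nat.choose_le_two_pow _ _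
        _ = 4 ^ Nat.log 4 N := by rw [pow_mul]; norm_num
        _ ≤ N := Nat.pow_log_le_self 4 hN.ne'
        _ ≤ N + 1 := Nat.le_succ N
  have h1 : IsPBounded (fun N : ℕ => N + 1) :=
    IsPBounded.add_holds IsPBounded.id (IsPBounded.const 1)
  have hk1 : IsPBounded (fun N : ℕ => (N + 1) ^ k + k) :=
    IsPBounded.add_holds (IsPBounded.pow_holds h1 k) (IsPBounded.const k)
  have hk2 : IsPBounded (fun N : ℕ => (N + 1) ^ k' + k') :=
    IsPBounded.add_holds (IsPBounded.pow_holds h1 k') (IsPBounded.const k')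
  have hβ : IsPBounded (fun N : ℕ => ((N + 1) * ((N + 1) ^ k + k) * ((N + 1) ^ k' + k')) ^ c) :=
    IsPBounded.pow_holds (IsPBounded.mul_holds (IsPBounded.mul_holds h1 hk1) hk2) c
  have hβmono : ∀ N : ℕ,
      ((2 * Nat.log 4 N).choose (Nat.log 4 N) * (((2 * Nat.log 4 N).choose (Nat.log 4 N)) ^ k + k) *
        (((2 * Nat.log 4 N).choose (Nat.log 4 N)) ^ k' + k')) ^ c ≤
      ((N + 1) * ((N + 1) ^ k + k) * ((N + 1) ^ k' + k')) ^ c := fun N =>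
    Nat.pow_le_pow_left (Nat.mul_le_mul (Nat.mul_le_mul (hM N)
      (Nat.add_le_add_right (Nat.pow_le_pow_left (hM N) k) k))
      (Nat.add_le_add_right (Nat.pow_le_pow_left (hM N) k') k')) c
  refine ⟨fun N => A (Nat.log 4 N), fun N => t (Nat.log 4 N), fun N => Cq (Nat.log 4 N),
    ⟨⟨1, fun N => by simpa using hM N⟩,
      IsPBounded.mono (IsPBounded.pow_holds h1 (k + 3)) fun N =>
        (hAdeg (Nat.log 4 N)).trans (Nat.pow_le_pow_left (hM N) _)⟩,
    IsPBounded.mono hβ fun N => (ht (Nat.log 4 N)).trans (hβmono N),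
    fun N => ⟨hC2 _, hCc _⟩,
    IsPBounded.mono hβ fun N => (hCs (Nat.log 4 N)).trans (hβmono N), ?_⟩
  -- not in `VP_F`: test the p-bound at `N = 4^n` for a large good `n`
  rintro ⟨-, e, he⟩
  set a₀ := 2 * e + 1 with ha₀
  obtain ⟨n, hn⟩ : ∃ n : ℕ,
      max (max (max n₁ n₂) 2) (max (n₀ (a₀ + (k + 3))) 1) ≤ n := ⟨_, le_rfl⟩
  have hb : max (max n₁ n₂) 2 ≤ n := le_trans (le_max_left _ _) hn
  have ha : n₀ (a₀ + (k + 3)) ≤ n := le_trans (le_trans (le_max_left _ _) (le_max_right _ _)) hn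
  have h1n : 1 ≤ n := le_trans (le_trans (le_max_right _ _) (le_max_right _ _)) hn
  have hlow := hhard n hb a₀ ha
  have hup := he (4 ^ n)
  simp only at hup
  rw [Nat.log_pow (by norm_num : 1 < 4)] at hup
  have hC : 2 ^ n ≤ (2 * n).choose n := by
    have := two_pow_le_centralBinom n
    rwa [Nat.centralBinom_eq_two_mul_choose] at this
  have hchain : (2 ^ n) ^ a₀ ≤ (4 ^ n) ^ e + e :=
    calc (2 ^ n) ^ a₀ ≤ ((2 * n).choose n) ^ a₀ := Nat.pow_le_pow_left hC _
      _ ≤ complexity (A n) := hlow.le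
      _ ≤ (4 ^ n) ^ e + e := hup
  have hsq : (2 ^ n) ^ a₀ = (4 ^ n) ^ e * 2 ^ n := by
    rw [ha₀, pow_succ, pow_mul, ← pow_mul 2 n 2, mul_comm n 2, pow_mul]
    norm_num
  have he4 : e < (4 ^ n) ^ e :=
    calc e < 2 ^ e := Nat.lt_two_pow_self
      _ ≤ (4 ^ n) ^ e := Nat.pow_le_pow_left
          (le_trans (by norm_num) (Nat.pow_le_pow_right (by norm_num) h1n)) _
  have h2n : 2 ≤ 2 ^ n :=
    calc 2 = 2 ^ 1 := (pow_one 2).symm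
      _ ≤ 2 ^ n := Nat.pow_le_pow_right (by norm_num) h1n
  have : (4 ^ n) ^ e + e < (2 ^ n) ^ a₀ := by
    rw [hsq]; nlinarith [he4, h2n]
  omega

end EncodedGenerators

end Literature.Barriers.ValiantsHypothesis
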